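import Mathlib
import Summits.ValiantsHypothesis.ValiantsHypothesis.Theorems.NewtonUnitEquationsDissociatedUniformTotalsLaw
import Summits.ValiantsHypothesis.ValiantsHypothesis.Theorems.NewtonUnitEquationsDissociatedUniformTotalsLawSweep
import Summits.ValiantsHypothesis.ValiantsHypothesis.Theorems.NewtonUnitEquationsDissociatedUniformTotalsLawHeavyPairs
import Summits.ValiantsHypothesis.ValiantsHypothesis.Theorems.NewtonUnitEquationsDissociatedUniformTotalsLawTriangleWords
import Summits.ValiantsHypothesis.ValiantsHypothesis.Theorems.NewtonUnitEquationsDissociatedUniformTotalsLawChartSamples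
import Summits.ValiantsHypothesis.ValiantsHypothesis.Theorems.NewtonUnitEquationsDissociatedUniformTotalsLawChartTriangles
import Literature.Computability.AlgebraicComplexity.NewtonPolygonTauProductBounds
import HarnessLib

/-!
# Crux `NewtonUnitEquations.DissociatedUniform` (stmt-ValiantsHypothesis-5905), `n = 3` totals law of model (Q**):
# the located class-free rung `TriWordsBound C` (tie-broken triangle words along a half-chart are `≤ C|G|²`) — the REPAIR of `TriangleBound`

`TriangleBound C` (`…TotalsLawTriangles`, p654434) counted words `(x,y,z)` whose three pair POINTS are exposed on their fibres by one
weight; it is false as typed for every `C` (constant curves, `…TotalsLawTrianglesDegenerate.not_triangleBound`).  Its honest form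
counts TIE-BROKEN triangle words: along the half-chart `σ = ±1`, at the generic sample times of `…TotalsLawChartSamples`, the words
`(x,y,z)` with `TPs (x+y) = x`, `TQs (y+z) = y`, `TRs (x+z) = x` at some sample (`triWords`, one spelling per exposed point).  These
still dominate the totals (`…ChartTriangles.sum_card_chartTops_le_card_triWords`), are `O(|G|^{5/2})` unconditionally
(`card_triWords_le_sqrt` below, from `…TriangleWords.card_triWords_le`), and are conjecturally `O(|G|²)`:
* `@[conjecture] TriWordsBound C` — OPEN, asserted nowhere.  CENSUS (this seat, exact event sweeps, HOME g14/exp/triwords_census.py):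
  per chart `#triWords/q² ≤ 1.32` on every family probed (random clouds `0.86 → 0.60` for `q = 8 → 24`; parabola pair × circle
  `1.16 → 0.98`; parabola gadget `1.09 → 0.87`; three circles `≤ 0.86`; huge third curve `1.08`; tiny third curve `1.32`; annealed
  maximisers of births at `q = 8`: `1.02`); both charts together `≤ 2.03 q²`.  Located constant `C = 2` (`C = 1` fails numerically).
* `totalsLawThree_of_triWordsBound : TriWordsBound C → TotalsLawThree (2C)` (the two half-charts), so `TriWordsBound 2` would give
  `TotalsLawThree 4` (recall `TotalsLawThree C` needs `C ≥ 3`, `…TotalsLawSharpness`).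
Honest label: location only; `TotalsLawThree` remains OPEN; VP ≠ VNP is not touched.
[folklore]
-/

set_option linter.dupNamespace false -- `ValiantsHypothesis.ValiantsHypothesis` (summit = problem) in every name

open Finset Matrix

namespace Summit.ValiantsHypothesis.ValiantsHypothesis.Theorems.NewtonUnitEquationsDissociatedUniform

namespace TotalsLaw

open Literature.Computability.AlgebraicComplexity.KPTT.PlanarMinkowski

/-- **Located class-free rung (OPEN): tie-broken triangle words along a half-chart are `≤ C|G|²`.**  For every finite abelian `G`,
all curves `a b c` and each half-chart `σ = ±1`, `#triWords (Nσ a b c σ) (TPs …) (TQs …) (TRs …) ≤ C·|G|²`.  Census supports `C = 2`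
(per chart `≤ 1.32 q²` on all families probed).  Not asserted anywhere. -/
@[conjecture] def TriWordsBound (C : ℕ) : Prop :=
  ∀ (G : Type) [AddCommGroup G] [Fintype G] [DecidableEq G] (a b c : G → (Fin 2 → ℝ)) (σ : ℝ), σ = 1 ∨ σ = -1 →
    (triWords (Nσ a b c σ) (TPs a b c σ) (TQs a b c σ) (TRs a b c σ)).card ≤ C * Fintype.card G ^ 2

variable {G : Type*} [AddCommGroup G] [Fintype G] [DecidableEq G]

/-- **Unconditionally `#triWords ≤ 54(⌊√|G|⌋ + 1)|G|²`** along each half-chart `σ ≠ 0` (the `O(|G|^{5/2})` bound of the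
companion files, in closed form). [folklore] -/
theorem card_triWords_le_sqrt (a b c : G → (Fin 2 → ℝ)) {σ : ℝ} (hσ : σ ≠ 0) :
    (triWords (Nσ a b c σ) (TPs a b c σ) (TQs a b c σ) (TRs a b c σ)).card ≤
      54 * (Nat.sqrt (Fintype.card G) + 1) * Fintype.card G ^ 2 := by
  set q := Fintype.card G with hq
  set k := Nat.sqrt q with hk
  have hK : 1 ≤ k + 1 := by omega
  have hmain := card_triWords_le (isIntervalSys_TPs (a := a) (b := b) (c := c) hσ (Nσ a b c σ))
    (isIntervalSys_TQs (a := a) (b := b) (c := c) hσ _) (isIntervalSys_TRs (a := a) (b := b) (c := c) hσ _) hK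
  have hlt : q < (k + 1) * (k + 1) := by have := Nat.lt_succ_sqrt' q; rw [hk, ← pow_two]; exact this
  have hdiv : 16 * q ^ 3 / (k + 1) ≤ 16 * (k + 1) * q ^ 2 := by
    refine (Nat.div_le_div_right (c := k + 1) (show 16 * q ^ 3 ≤ 16 * ((k + 1) * (k + 1)) * q ^ 2 from ?_)).trans ?_
    · have : q ^ 3 ≤ (k + 1) * (k + 1) * q ^ 2 := by
        rw [pow_succ, mul_comm]
        exact Nat.mul_le_mul_right _ hlt.le
      calc 16 * q ^ 3 ≤ 16 * ((k + 1) * (k + 1) * q ^ 2) := Nat.mul_le_mul_left _ this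
        _ = 16 * ((k + 1) * (k + 1)) * q ^ 2 := by ring
    · rw [show 16 * ((k + 1) * (k + 1)) * q ^ 2 = (16 * (k + 1) * q ^ 2) * (k + 1) by ring, Nat.mul_div_cancel _ (by omega)]
  calc (triWords (Nσ a b c σ) (TPs a b c σ) (TQs a b c σ) (TRs a b c σ)).card
      ≤ 3 * (2 * (k + 1) * q ^ 2 + 16 * q ^ 3 / (k + 1)) := hmain
    _ ≤ 3 * (2 * (k + 1) * q ^ 2 + 16 * (k + 1) * q ^ 2) := by gcongr
    _ = 54 * (k + 1) * q ^ 2 := by ring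

open Classical in
/-- **`TriWordsBound C → TotalsLawThree (2C)`**: hull vertices are chart tops of one of the two half-charts, and chart tops inject
into triangle words. -/
theorem totalsLawThree_of_triWordsBound (C : ℕ) (h : TriWordsBound C) : TotalsLawThree (2 * C) := by
  intro G _ _ a b c
  classical
  have h₁ := (sum_card_chartTops_le_card_triWords a b c (1 : ℝ)).trans (h G a b c 1 (Or.inl rfl))
  have h₂ := (sum_card_chartTops_le_card_triWords a b c (-1 : ℝ)).trans (h G a b c (-1) (Or.inr rfl))
  unfold totalVert
  calc ∑ s, classVert a b c s ≤ _ := sum_le_sum fun s _ => classVert_le_card_chartTops_add a b c s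
    _ ≤ C * Fintype.card G ^ 2 + C * Fintype.card G ^ 2 := by rw [sum_add_distrib]; exact add_le_add h₁ h₂
    _ = 2 * C * Fintype.card G ^ 2 := by ring

end TotalsLaw

end Summit.ValiantsHypothesis.ValiantsHypothesis.Theorems.NewtonUnitEquationsDissociatedUniform
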